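/-
Copyright (c) 2026 the pub-hodgecm-mathlib formalisation cell (harness21).  Prover seat hodgecm-mathlib-LH4-p03 (g8); LAYER C (C2) file C2-B of LH4-p01 (g6)'s census
`CENSUS-C2-PHTower.v1` (565a49c0), dealer LH4-plan (g7) WORD #20, 2026-09-02.  Count-neutral base layer of the dyadic (D-UNR) column (FINDINGS #6∕#6′∕#11∕#16 of the LH4 board).
-/
import Literature.NumberTheory.Automorphic.UnitaryThreePHTowerIndex                 -- ★ (F3c-β-ii) FILE C: `coe_mul_of_coe_eq`, `toQuotPow_add∕neg∕zero`, `quotientMap_toQuotPow`, `v_mul_map_sub_one_le` (CITE) + FILES A∕B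
import Literature.NumberTheory.Automorphic.UnitaryThreeBorelNormalFormUnramified      -- ★ (i) LH5-p05: the primed Borel pair `exists_coe_eq_borel_of_mem_flickerPH'`, `exists_mem_flickerPH_coe_eq'` (`hσσ hvσ h2`)
import Literature.NumberTheory.Automorphic.UnitaryThreeDoubleCosetsHKStabilizerTrace  -- ★ p851832 (LAYER B 2∕3): `flickerU_of_rel_inv_mul_mul_mem_unitaryInt_iff` for `u_m^{(y,z)}`
import HarnessLib

/-!
# The PH-tower for Flicker's Prop. 8 (ii) WITHOUT `|2| = 1`, FILE C2-B: `P_H ∩ H^K_m ≤ N₀(ϖ^m)` and **`[N₀(ϖ^m) : P_H ∩ H^K_m] = #{β ∈ 𝒪⧸𝓂^m : σ̄β = −β}`** (H2)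
# for the 2-free level elements `u_m^{(y,z)}` — every residue characteristic
(Flicker, *Elementary proof of the fundamental lemma for a unitary group* (1998), Prop. 8 pp. 84–85)

Topic `NumberTheory/Automorphic`; namespace `Literature.NumberTheory.Automorphic.UnitaryGroup`.  THEOREMS ONLY (no `def`, no instance, no notation, no named fact, no `sorry`).
Cell `pub/hodgecm-mathlib`, crux H413 = `stmt-HodgeConjecture-24833`; LH4 board (D-UNR), LAYER C block (C2) «PH-TOWER» of the census-of-record CENSUS-C2-PHTower 565a49c0
(LH4-p01 (g6)) §1∕§2, file C2-B (dealer LH4-plan (g7) WORD #20); companions C2-A `UnitaryThreePHTowerRhoUnramified` (LH4-p01), C2-C `UnitaryThreePHTowerPackageTrace`.  Evidence that the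
VALUES persist at `q = 2^f`: CENSUS-R1 52a4c879 ∕ FINDING #6′; the COUNT heads stay hypotheses of the G-side until LAYER C closes.

THE TWIN.  ★ `UnitaryThreePHTowerIndex` (FILE C of the tower) reads Flicker's level element `u_m` (`yσy = −2`) through ★ (C2) and `|2| = 1` through the anti-fixed-class lift
`y₀ := (b − σb)∕2`.  Here `u = u_m^{(y,z)} = !![ϖ^m, y, z·ϖ^{−m}; 0, 1, −σy·ϖ^{−m}; 0, 0, ϖ^{−m}]` (`z + σz + yσy = 0`, `|y| = 1`, `|z| ≤ 1`; ★ p851802∕p851832), the datum is ★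
`UnramifiedLocalConjDatum` + the characteristic token `(h2 : (2 : K) ≠ 0)` (block shape only, free at `L_w`), and the two `|2|`-devices are replaced as follows (census §0 (1)(3), FINDING #16):
* the THIRD CONGRUENCE of the criterion becomes `|u₁x + z(u₁ − w) + σz((σu₁)⁻¹ − w)| ≤ |t|²` (★'s `u₁ + u₁x + (σu₁)⁻¹ − 2w` is the instance `z = 1`) — ★ p851832 at `γ = 0`;
* the CHARACTER is `χ^{(z)}(p(u₁,x,w)) := (x + z·(a − 1) − σ(z·(a − 1)))∕t`, `a = u₁w⁻¹` (★'s `(x + a − σa)∕t` at `z = 1`), with kernel identity `E^{(z)}·σa·w⁻¹ = t·χ^{(z)} + R`,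
  `R = z·(a−1)(σa−1) + x·(aσa − 1)`, `|R| ≤ |t|²` on `N₀` (census §2);
* the IMAGE LIFT is the τ-lift `y₀ := b − τ·(b + σb)`, `⟨τ, _, hτ⟩ := hd.trace` (`σy₀ = −y₀` since `(b + σb)(1 − τ − στ) = 0`; `|y₀ − b| ≤ |τ|·|b + σb| ≤ |t|`) — every residue
  characteristic, replacing `(b − σb)∕2`.
* `mem_flickerHK_iff_of_coe_eq_borel_of_rel`, **`inf_flickerHK_le_flickerPH0_of_rel`** (H2, inclusion), `exists_coe_eq_of_mem_flickerPH0_of_unram` (coordinates on `N₀`, ★ verbatim over the primed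
  Borel head), **`index_inf_flickerHK_subgroupOf_flickerPH0_of_rel`** (H2) — RHS `Nat.card {β ∕∕ σ̄β = −β}` VERBATIM (`= q^m` by ★ `natCard_antifixed_quotient_pow`, 2-free).
HONEST LABEL: HC_CM is proved only modulo the printed citations (hLiu418 = `stmt-HodgeConjecture-24832`, h413 = `stmt-HodgeConjecture-24833`) until rung 0 closes; structure theory, pays no
organ, opens no road ((D-UNR) stays PRINT by D74′; LAYER C pays the type-(1) row in house only when it closes).

## References
* [Flicker1998UnitaryFL] Y. Z. Flicker, *Elementary proof of the fundamental lemma for a unitary group*, Canad. J. Math. 50 (1998), Prop. 8 pp. 84–85.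
* [Serre1979] J.-P. Serre, *Local Fields*, GTM 67 (1979), Ch. V §2 (trace surjectivity in unramified extensions — the source of `τ`).
-/

open scoped MatrixGroups WithZero Valued
open Matrix

namespace Literature.NumberTheory.Automorphic

namespace UnitaryGroup

open Literature.NumberTheory.Automorphic.HermitianLattice (unitaryInt mem_unitaryInt_iff UnramifiedLocalConjDatum)

section HTwo

variable {K : Type*} [Field K] [Valued K ℤᵐ⁰] {ϖ : K} (σ : K →+* K) {J : Matrix (Fin 3) (Fin 3) K} (hJ : J = (StdForm.antidiagonal 3).over K)

include hJ in
/-- ★ LAYER B 2∕3 for an element of `P_H` in coordinates, level element `u_m^{(y,z)}`: `p(u₁,x,w) ∈ H^K_m ↔ |u₁ − w| ≤ |ϖ^m| ∧ |(σu₁)⁻¹ − w| ≤ |ϖ^m| ∧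
|u₁x + z(u₁ − w) + σz((σu₁)⁻¹ − w)| ≤ |ϖ^m|²` (★ p851832 `flickerU_of_rel_inv_mul_mul_mem_unitaryInt_iff` at `γ = 0`; ★'s third congruence is the instance `z = 1`).
[cite: Flicker1998UnitaryFL, Prop. 8 pp. 84–85] -/
theorem mem_flickerHK_iff_of_coe_eq_borel_of_rel (hd : UnramifiedLocalConjDatum σ ϖ) {y z : K} (hy : Valued.v y = 1) (hz : z + σ z + y * σ y = 0) (m : ℕ)
    {um c p : ↥(unitaryGroupOfForm σ J)}
    (hum : ((um : GL (Fin 3) K) : Matrix (Fin 3) (Fin 3) K) = !![ϖ ^ m, y, z * (ϖ ^ m)⁻¹; 0, 1, -σ y * (ϖ ^ m)⁻¹; 0, 0, (ϖ ^ m)⁻¹])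
    (hp : p ∈ flickerPH σ J c) {u₁ x w : K}
    (hcoe : ((p : GL (Fin 3) K) : Matrix (Fin 3) (Fin 3) K) = !![u₁, 0, u₁ * x; 0, w, 0; 0, 0, (σ u₁)⁻¹]) :
    p ∈ flickerHK σ J c um ↔ Valued.v (u₁ - w) ≤ Valued.v (ϖ ^ m) ∧ Valued.v ((σ u₁)⁻¹ - w) ≤ Valued.v (ϖ ^ m) ∧
      Valued.v (u₁ * x + z * (u₁ - w) + σ z * ((σ u₁)⁻¹ - w)) ≤ Valued.v (ϖ ^ m) * Valued.v (ϖ ^ m) := by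
  have hH : p ∈ Subgroup.centralizer ({c} : Set ↥(unitaryGroupOfForm σ J)) := (mem_flickerKH_iff.1 (mem_flickerPH_iff'.1 hp).1).1
  rw [mem_flickerHK_iff, flickerU_of_rel_inv_mul_mul_mem_unitaryInt_iff σ hJ hd hy hz m hum hcoe]
  simp only [hH, true_and, map_zero, zero_le, zero_mul, add_zero, zero_add]

include hJ in
/-- **(H2, inclusion) `P_H ∩ H^K_m ≤ N₀(ϖ^m)`** for `u_m^{(y,z)}` (`|y| = 1`, `|z| ≤ 1`): on `P_H ∩ H^K_m`, `u₁ ≡ w` and `x ≡ 0 (mod ϖ^m)` (from the three congruences: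
`u₁x = E^{(z)} − z(u₁ − w) − σz((σu₁)⁻¹ − w)`).  Twin of ★ `inf_flickerHK_le_flickerPH0`. [cite: Flicker1998UnitaryFL, Prop. 8 pp. 84–85] -/
theorem inf_flickerHK_le_flickerPH0_of_rel (hd : UnramifiedLocalConjDatum σ ϖ) (h2 : (2 : K) ≠ 0) {y z : K} (hy : Valued.v y = 1)
    (hzv : Valued.v z ≤ 1) (hz : z + σ z + y * σ y = 0) (m : ℕ)
    {um c : ↥(unitaryGroupOfForm σ J)}
    (hum : ((um : GL (Fin 3) K) : Matrix (Fin 3) (Fin 3) K) = !![ϖ ^ m, y, z * (ϖ ^ m)⁻¹; 0, 1, -σ y * (ϖ ^ m)⁻¹; 0, 0, (ϖ ^ m)⁻¹])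
    (hc : ((c : GL (Fin 3) K) : Matrix (Fin 3) (Fin 3) K) = !![1, 0, 0; 0, -1, 0; 0, 0, 1]) :
    flickerPH σ J c ⊓ flickerHK σ J c um ≤ flickerPH0 σ J c (ϖ ^ m) := by
  rintro p ⟨hp, hK⟩
  obtain ⟨u₁, x, w, hcoe, hu, hx, -, hw, hσw⟩ := exists_coe_eq_borel_of_mem_flickerPH' σ hJ hd.σσ hd.vσ h2 hc hp
  obtain ⟨h1, h2', h3⟩ := (mem_flickerHK_iff_of_coe_eq_borel_of_rel σ hJ hd hy hz m hum hp hcoe).1 hK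
  have hσzv : Valued.v (σ z) ≤ 1 := by rw [hd.vσ]; exact hzv
  have hw0 : w ≠ 0 := fun h => by rw [h, map_zero] at hw; exact zero_ne_one hw
  have ht1 : Valued.v (ϖ ^ m) ≤ 1 := hd.v_pow_le_one m
  refine (mem_flickerPH0_iff_of_coe_eq σ hJ hd.vσ hd.σσ hp hcoe hu hw hσw (ϖ ^ m)).2 ⟨?_, ?_⟩
  · rw [show u₁ * w⁻¹ - 1 = (u₁ - w) * w⁻¹ by field_simp, map_mul, map_inv₀, hw, inv_one, mul_one]; exact h1
  · have e : x = u₁⁻¹ * ((u₁ * x + z * (u₁ - w) + σ z * ((σ u₁)⁻¹ - w)) - z * (u₁ - w) - σ z * ((σ u₁)⁻¹ - w)) := by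
      have hu0 : u₁ ≠ 0 := fun h => by rw [h, map_zero] at hu; exact zero_ne_one hu
      field_simp; ring
    rw [e, map_mul, map_inv₀, hu, inv_one, one_mul]
    refine Valuation.map_sub_le _ (Valuation.map_sub_le _ (h3.trans ((mul_le_mul' ht1 le_rfl).trans (by rw [one_mul]))) ?_) ?_
    · rw [map_mul]; exact (mul_le_mul' hzv h1).trans (by rw [one_mul])
    · rw [map_mul]; exact (mul_le_mul' hσzv h2').trans (by rw [one_mul])

end HTwo

section Index

variable {K : Type*} [Field K] [Valued K ℤᵐ⁰] {ϖ : K} (σ : K →+* K) {J : Matrix (Fin 3) (Fin 3) K} (hJ : J = (StdForm.antidiagonal 3).over K)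

include hJ in
/-- Coordinates of an element of `N₀(t)`: `p = p(u₁, x, w)` with `|u₁ w⁻¹ − 1| ≤ |t|`, `|x| ≤ |t|` (★ (i) `exists_coe_eq_borel_of_mem_flickerPH'` + ★ `mem_flickerPH0_iff_of_coe_eq`); datum
`UnramifiedLocalConjDatum` + characteristic token `h2`.  Twin of ★ `exists_coe_eq_of_mem_flickerPH0`. [cite: Flicker1998UnitaryFL, Prop. 8 pp. 84–85] -/
theorem exists_coe_eq_of_mem_flickerPH0_of_unram (hd : UnramifiedLocalConjDatum σ ϖ) (h2 : (2 : K) ≠ 0) {c p : ↥(unitaryGroupOfForm σ J)}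
    (hc : ((c : GL (Fin 3) K) : Matrix (Fin 3) (Fin 3) K) = !![1, 0, 0; 0, -1, 0; 0, 0, 1]) {t : K} (hp : p ∈ flickerPH0 σ J c t) :
    ∃ u₁ x w : K, ((p : GL (Fin 3) K) : Matrix (Fin 3) (Fin 3) K) = !![u₁, 0, u₁ * x; 0, w, 0; 0, 0, (σ u₁)⁻¹] ∧
      Valued.v u₁ = 1 ∧ Valued.v x ≤ 1 ∧ σ x = -x ∧ Valued.v w = 1 ∧ σ w * w = 1 ∧
      Valued.v (u₁ * w⁻¹ - 1) ≤ Valued.v t ∧ Valued.v x ≤ Valued.v t := by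
  have hP : p ∈ flickerPH σ J c := flickerPH0_le c t hp
  obtain ⟨u₁, x, w, hcoe, hu, hx, hσx, hw, hσw⟩ := exists_coe_eq_borel_of_mem_flickerPH' σ hJ hd.σσ hd.vσ h2 hc hP
  obtain ⟨h1, h2'⟩ := (mem_flickerPH0_iff_of_coe_eq σ hJ hd.vσ hd.σσ hP hcoe hu hw hσw t).1 hp
  exact ⟨u₁, x, w, hcoe, hu, hx, hσx, hw, hσw, h1, h2'⟩

include hJ in
/-- **(H2) FLICKER'S PROP. 8 (ii), THE SECOND STEP OF THE TOWER, for `u_m^{(y,z)}` at every residue characteristic: `[N₀(ϖ^m) : P_H ∩ H^K_m] = #{β ∈ 𝒪⧸𝓂^m : σ̄β = −β}`**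
(`= q^m` by ★ `natCard_antifixed_quotient_pow`).  PROOF: on `N₀ = N₀(ϖ^m)` the map `χ^{(z)}(p(u₁,x,w)) := (x + z·(a − 1) − σ(z·(a − 1)))∕ϖ^m mod 𝓂^m`, `a = u₁w⁻¹`, is a
homomorphism to `(𝒪⧸𝓂^m, +)` (crossed terms `x∕N(u₁′) − x` and `z(a−1)(a′−1) − σ(z(a−1)(a′−1))` are `O(ϖ^{2m})`), its kernel is `P_H ∩ H^K_m` (the third congruence of
★ `mem_flickerHK_iff_of_coe_eq_borel_of_rel`: `E^{(z)}·σa·w⁻¹ = ϖ^m χ^{(z)} + R`, `R = z(a−1)(σa−1) + x(aσa−1)`, `|R| ≤ |ϖ^m|²`), and its image is exactly the anti-fixed classes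
(`σχ^{(z)} = −χ^{(z)}`; `p(1, ϖ^m y₀, 1) ↦ ȳ₀` with the τ-LIFT `y₀ := b − τ(b + σb)`, `τ + στ = 1` from `hd.trace` — no `½`).  Twin of ★ `index_inf_flickerHK_subgroupOf_flickerPH0`.
[cite: Flicker1998UnitaryFL, Prop. 8 pp. 84–85] [cite: Serre1979, Ch. V §2] -/
theorem index_inf_flickerHK_subgroupOf_flickerPH0_of_rel (hd : UnramifiedLocalConjDatum σ ϖ) (h2 : (2 : K) ≠ 0) {y z : K} (hy : Valued.v y = 1)
    (hzv : Valued.v z ≤ 1) (hz : z + σ z + y * σ y = 0)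
    (hσO : ∀ z₀ : 𝒪[K], (σ.comp 𝒪[K].subtype) z₀ ∈ 𝒪[K]) (m : ℕ) {um c : ↥(unitaryGroupOfForm σ J)}
    (hum : ((um : GL (Fin 3) K) : Matrix (Fin 3) (Fin 3) K) = !![ϖ ^ m, y, z * (ϖ ^ m)⁻¹; 0, 1, -σ y * (ϖ ^ m)⁻¹; 0, 0, (ϖ ^ m)⁻¹])
    (hc : ((c : GL (Fin 3) K) : Matrix (Fin 3) (Fin 3) K) = !![1, 0, 0; 0, -1, 0; 0, 0, 1]) :
    ((flickerPH σ J c ⊓ flickerHK σ J c um).subgroupOf (flickerPH0 σ J c (ϖ ^ m))).index =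
      Nat.card {β : 𝒪[K] ⧸ 𝓂[K] ^ m //
        Ideal.quotientMap (𝓂[K] ^ m) ((σ.comp 𝒪[K].subtype).codRestrict 𝒪[K] hσO)
          (maximalIdeal_pow_le_comap_codRestrict σ hd.vϖ hd.vσ hσO m) β = -β} := by
  have hσσ : ∀ a, σ (σ a) = a := hd.σσ
  have hσv : ∀ a, Valued.v (σ a) = Valued.v a := hd.vσ
  have hσzv : Valued.v (σ z) ≤ 1 := by rw [hσv]; exact hzv
  have hϖ0 : ϖ ≠ 0 := hd.ϖ_ne_zero
  set t : K := ϖ ^ m with ht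
  have ht0 : t ≠ 0 := pow_ne_zero _ hϖ0
  have vt0 : 0 < Valued.v t := (Valuation.pos_iff _).2 ht0
  have ht1 : Valued.v t ≤ 1 := by rw [ht]; exact hd.v_pow_le_one m
  have hσt : σ t = t := by rw [ht, map_pow, hd.σϖ]
  set σq := Ideal.quotientMap (𝓂[K] ^ m) ((σ.comp 𝒪[K].subtype).codRestrict 𝒪[K] hσO)
    (maximalIdeal_pow_le_comap_codRestrict σ hd.vϖ hd.vσ hσO m) with hσq
  -- the character `χ` on matrices
  let chi : ↥(unitaryGroupOfForm σ J) → K := fun p =>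
    (((p : GL (Fin 3) K) : Matrix (Fin 3) (Fin 3) K) 0 2 * (((p : GL (Fin 3) K) : Matrix (Fin 3) (Fin 3) K) 0 0)⁻¹ +
      z * (((p : GL (Fin 3) K) : Matrix (Fin 3) (Fin 3) K) 0 0 * (((p : GL (Fin 3) K) : Matrix (Fin 3) (Fin 3) K) 1 1)⁻¹ - 1) -
      σ (z * (((p : GL (Fin 3) K) : Matrix (Fin 3) (Fin 3) K) 0 0 * (((p : GL (Fin 3) K) : Matrix (Fin 3) (Fin 3) K) 1 1)⁻¹ - 1))) / t
  have hchi : ∀ (p : ↥(unitaryGroupOfForm σ J)) (u₁ x w : K),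
      ((p : GL (Fin 3) K) : Matrix (Fin 3) (Fin 3) K) = !![u₁, 0, u₁ * x; 0, w, 0; 0, 0, (σ u₁)⁻¹] → u₁ ≠ 0 →
      chi p = (x + z * (u₁ * w⁻¹ - 1) - σ (z * (u₁ * w⁻¹ - 1))) / t := by
    intro p u₁ x w hcoe hu0
    simp only [chi, hcoe]
    simp [mul_comm u₁ x]
    rw [mul_inv_cancel_right₀ hu0]
  -- `χ` in coordinates: integrality
  have hchi_v : ∀ {u₁ x w : K}, Valued.v u₁ = 1 → Valued.v w = 1 → Valued.v (u₁ * w⁻¹ - 1) ≤ Valued.v t → Valued.v x ≤ Valued.v t →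
      Valued.v (x + z * (u₁ * w⁻¹ - 1) - σ (z * (u₁ * w⁻¹ - 1))) ≤ Valued.v t := by
    intro u₁ x w hu hw h1 h2
    refine Valuation.map_sub_le _ (Valuation.map_add_le _ h2 ?_) ?_
    · rw [map_mul]; exact (mul_le_mul' hzv h1).trans (by rw [one_mul])
    · rw [hσv, map_mul]; exact (mul_le_mul' hzv h1).trans (by rw [one_mul])
  -- the homomorphism
  let f : ↥(flickerPH0 σ J c t) →* Multiplicative (𝒪[K] ⧸ 𝓂[K] ^ m) :=
    { toFun := fun p => Multiplicative.ofAdd (toQuotPow m (chi p))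
      map_one' := by
        change Multiplicative.ofAdd (toQuotPow m (chi 1)) = 1
        have h1 : chi 1 = 0 := by
          simp only [chi, OneMemClass.coe_one, Units.val_one]
          simp [Matrix.one_apply_ne (show (0 : Fin 3) ≠ 2 by decide)]
        rw [h1, toQuotPow_zero, ofAdd_zero]
      map_mul' := by
        intro p p'
        change Multiplicative.ofAdd (toQuotPow m (chi (p * p' : ↥(unitaryGroupOfForm σ J)))) =
          Multiplicative.ofAdd (toQuotPow m (chi p)) * Multiplicative.ofAdd (toQuotPow m (chi p'))
        obtain ⟨u₁, x, w, hcoe, hu, hx, -, hw, hσw, ha, hxt⟩ := exists_coe_eq_of_mem_flickerPH0_of_unram σ hJ hd h2 hc p.2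
        obtain ⟨u₁', x', w', hcoe', hu', hx', -, hw', hσw', ha', hxt'⟩ := exists_coe_eq_of_mem_flickerPH0_of_unram σ hJ hd h2 hc p'.2
        have hu0 : u₁ ≠ 0 := fun h => by rw [h, map_zero] at hu; exact zero_ne_one hu
        have hu0' : u₁' ≠ 0 := fun h => by rw [h, map_zero] at hu'; exact zero_ne_one hu'
        have hw0 : w ≠ 0 := fun h => by rw [h, map_zero] at hw; exact zero_ne_one hw
        have hw0' : w' ≠ 0 := fun h => by rw [h, map_zero] at hw'; exact zero_ne_one hw'
        have hσu0' : σ u₁' ≠ 0 := fun h => hu0' (by rw [← hσσ u₁', h, map_zero])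
        have hcoe'' := coe_mul_of_coe_eq σ hcoe hcoe' hu0' hσu0'
        have c1 := hchi p u₁ x w hcoe hu0
        have c2 := hchi p' u₁' x' w' hcoe' hu0'
        have c3 := hchi (p * p' : ↥(unitaryGroupOfForm σ J)) (u₁ * u₁') (x' + x / (u₁' * σ u₁')) (w * w') hcoe'' (mul_ne_zero hu0 hu0')
        have i1 := hchi_v hu hw ha hxt
        have i2 := hchi_v hu' hw' ha' hxt'
        have i1' : Valued.v (chi p) ≤ 1 := by rw [c1, map_div₀, div_le_one₀ vt0]; exact i1
        have i2' : Valued.v (chi p') ≤ 1 := by rw [c2, map_div₀, div_le_one₀ vt0]; exact i2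
        rw [← ofAdd_add, ← toQuotPow_add m i1' i2']
        congr 1
        have i3' : Valued.v (chi (p * p' : ↥(unitaryGroupOfForm σ J))) ≤ 1 := by
          have hmem : (p * p' : ↥(unitaryGroupOfForm σ J)) ∈ flickerPH0 σ J c t := Subgroup.mul_mem _ p.2 p'.2
          obtain ⟨U, X, W, hC, hU, hX, -, hW, -, hA, hXt⟩ := exists_coe_eq_of_mem_flickerPH0_of_unram σ hJ hd h2 hc hmem
          rw [hchi _ U X W hC (fun h => by rw [h, map_zero] at hU; exact zero_ne_one hU), map_div₀, div_le_one₀ vt0]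
          exact hchi_v hU hW hA hXt
        rw [toQuotPow_eq_toQuotPow_iff hd.vϖ m i3' (Valuation.map_add_le _ i1' i2'), c1, c2, c3]
        -- the crossed terms are `O(t²)`
        set a : K := u₁ * w⁻¹ with ha_def
        set a' : K := u₁' * w'⁻¹ with ha_def'
        have hN : Valued.v (x / (u₁' * σ u₁') - x) ≤ Valued.v t * Valued.v t := by
          have hsw' : σ w' = w'⁻¹ := by rw [← mul_eq_one_iff_eq_inv₀ hw0']; exact hσw'
          have e : x / (u₁' * σ u₁') - x = -(x * (u₁' * σ u₁')⁻¹) * (a' * σ a' - 1) := by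
            rw [ha_def', map_mul, map_inv₀, hsw', inv_inv]; field_simp; ring
          rw [e, map_mul, Valuation.map_neg, map_mul, map_inv₀, map_mul, hσv, hu', mul_one, inv_one, mul_one]
          refine mul_le_mul' hxt ((v_mul_map_sub_one_le σ hσv ?_).trans ha')
          rw [ha_def', map_mul, map_inv₀, hu', hw', inv_one, mul_one]
        have e : (x' + x / (u₁' * σ u₁') + z * (u₁ * u₁' * (w * w')⁻¹ - 1) - σ (z * (u₁ * u₁' * (w * w')⁻¹ - 1))) / t -
            ((x + z * (a - 1) - σ (z * (a - 1))) / t + (x' + z * (a' - 1) - σ (z * (a' - 1))) / t) =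
            ((x / (u₁' * σ u₁') - x) + z * ((a - 1) * (a' - 1)) - σ (z * ((a - 1) * (a' - 1)))) / t := by
          rw [ha_def, ha_def']; simp only [map_mul, map_inv₀, map_sub, map_one]; field_simp; ring
        rw [e, map_div₀, div_le_iff₀ vt0]
        refine Valuation.map_sub_le _ (Valuation.map_add_le _ hN ?_) ?_
        · rw [map_mul, map_mul]; exact (mul_le_mul' hzv (mul_le_mul' ha ha')).trans (by rw [one_mul])
        · rw [hσv, map_mul, map_mul]; exact (mul_le_mul' hzv (mul_le_mul' ha ha')).trans (by rw [one_mul]) }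
  -- the kernel of `f` is `P_H ∩ H^K_m`
  have hker : f.ker = (flickerPH σ J c ⊓ flickerHK σ J c um).subgroupOf (flickerPH0 σ J c t) := by
    ext p
    rw [MonoidHom.mem_ker, Subgroup.mem_subgroupOf, Subgroup.mem_inf]
    change Multiplicative.ofAdd (toQuotPow m (chi p)) = 1 ↔ _
    have hP : (p : ↥(unitaryGroupOfForm σ J)) ∈ flickerPH σ J c := flickerPH0_le c t p.2
    obtain ⟨u₁, x, w, hcoe, hu, hx, -, hw, hσw, ha, hxt⟩ := exists_coe_eq_of_mem_flickerPH0_of_unram σ hJ hd h2 hc p.2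
    have hu0 : u₁ ≠ 0 := fun h => by rw [h, map_zero] at hu; exact zero_ne_one hu
    have hw0 : w ≠ 0 := fun h => by rw [h, map_zero] at hw; exact zero_ne_one hw
    have hσu0 : σ u₁ ≠ 0 := fun h => hu0 (by rw [← hσσ u₁, h, map_zero])
    have hsw : σ w = w⁻¹ := by rw [← mul_eq_one_iff_eq_inv₀ hw0]; exact hσw
    have c1 := hchi p u₁ x w hcoe hu0
    have i1 : Valued.v (chi p) ≤ 1 := by rw [c1, map_div₀, div_le_one₀ vt0]; exact hchi_v hu hw ha hxt
    rw [← ofAdd_zero, Multiplicative.ofAdd.apply_eq_iff_eq, ← toQuotPow_zero m,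
      toQuotPow_eq_toQuotPow_iff hd.vϖ m i1 (by rw [map_zero]; exact zero_le), sub_zero,
      mem_flickerHK_iff_of_coe_eq_borel_of_rel σ hJ hd hy hz m hum hP hcoe, and_iff_right hP]
    set a : K := u₁ * w⁻¹ with ha_def
    -- the first two congruences hold on `N₀`
    have k1 : Valued.v (u₁ - w) ≤ Valued.v t := by
      rw [show u₁ - w = (a - 1) * w by rw [ha_def]; field_simp, map_mul, hw, mul_one]; exact ha
    have k2 : Valued.v ((σ u₁)⁻¹ - w) ≤ Valued.v t := by
      have e : (σ u₁)⁻¹ - w = -((σ u₁)⁻¹ * w) * σ (u₁ - w) := by rw [map_sub, hsw]; field_simp; ring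
      rw [e, map_mul, Valuation.map_neg, map_mul, map_inv₀, hσv, hu, inv_one, one_mul, hw, one_mul, hσv]; exact k1
    -- the third: `E·σa·w⁻¹ = t·χ + R`
    have va : Valued.v a = 1 := by rw [ha_def, map_mul, map_inv₀, hu, hw, inv_one, mul_one]
    have vσa : Valued.v (σ a) = 1 := by rw [hσv, va]
    have hσa0 : σ a ≠ 0 := fun h => by rw [h, map_zero] at vσa; exact zero_ne_one vσa
    have eE : (u₁ * x + z * (u₁ - w) + σ z * ((σ u₁)⁻¹ - w)) * (σ a * w⁻¹) =
        t * ((x + z * (a - 1) - σ (z * (a - 1))) / t) + (z * ((a - 1) * (σ a - 1)) + x * (a * σ a - 1)) := by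
      rw [ha_def, map_mul, map_inv₀, hsw, inv_inv, map_mul, map_sub, map_one, map_mul, map_inv₀, hsw, inv_inv]; field_simp; ring
    have hR : Valued.v (z * ((a - 1) * (σ a - 1)) + x * (a * σ a - 1)) ≤ Valued.v t * Valued.v t := by
      refine Valuation.map_add_le _ ?_ ?_
      · have e4 : (a - 1) * (σ a - 1) = (a - 1) * σ (a - 1) := by simp only [map_sub, map_one]
        rw [map_mul, e4, map_mul, hσv]; exact (mul_le_mul' hzv (mul_le_mul' ha ha)).trans (by rw [one_mul])
      · rw [map_mul]; exact mul_le_mul' hxt ((v_mul_map_sub_one_le σ hσv va.le).trans ha)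
    have key : Valued.v (u₁ * x + z * (u₁ - w) + σ z * ((σ u₁)⁻¹ - w)) =
        Valued.v (t * ((x + z * (a - 1) - σ (z * (a - 1))) / t) + (z * ((a - 1) * (σ a - 1)) + x * (a * σ a - 1))) := by
      rw [← eE, map_mul, map_mul, map_inv₀, vσa, hw, inv_one, mul_one, mul_one]
    rw [← c1] at key
    rw [key, and_iff_right k1, and_iff_right k2]
    constructor
    · intro h
      refine Valuation.map_add_le _ ?_ hR
      rw [map_mul]; exact mul_le_mul' le_rfl h
    · intro h
      have h' : Valued.v (t * chi p) ≤ Valued.v t * Valued.v t := by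
        have e : t * chi p = (t * chi p + (z * ((a - 1) * (σ a - 1)) + x * (a * σ a - 1))) - (z * ((a - 1) * (σ a - 1)) + x * (a * σ a - 1)) := by ring
        rw [e]; exact Valuation.map_sub_le _ h hR
      rw [map_mul] at h'
      calc Valued.v (chi p) = (Valued.v t)⁻¹ * (Valued.v t * Valued.v (chi p)) := by rw [inv_mul_cancel_left₀ vt0.ne']
        _ ≤ (Valued.v t)⁻¹ * (Valued.v t * Valued.v t) := mul_le_mul' le_rfl h'
        _ = Valued.v t := by rw [inv_mul_cancel_left₀ vt0.ne']
  -- the image of `f` is the anti-fixed classes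
  have hrange : ∀ g : Multiplicative (𝒪[K] ⧸ 𝓂[K] ^ m), g ∈ f.range ↔ σq (Multiplicative.toAdd g) = -Multiplicative.toAdd g := by
    intro g
    constructor
    · rintro ⟨p, rfl⟩
      change σq (toQuotPow m (chi p)) = -toQuotPow m (chi p)
      obtain ⟨u₁, x, w, hcoe, hu, hx, hσx, hw, hσw, ha, hxt⟩ := exists_coe_eq_of_mem_flickerPH0_of_unram σ hJ hd h2 hc p.2
      have hu0 : u₁ ≠ 0 := fun h => by rw [h, map_zero] at hu; exact zero_ne_one hu
      have c1 := hchi p u₁ x w hcoe hu0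
      have i1 : Valued.v (chi p) ≤ 1 := by rw [c1, map_div₀, div_le_one₀ vt0]; exact hchi_v hu hw ha hxt
      rw [hσq, quotientMap_toQuotPow σ hd.vϖ hσv hσO m i1, ← toQuotPow_neg m i1]
      congr 1
      rw [c1, map_div₀, hσt, map_sub, map_add, hσσ, hσx]; ring
    · intro hg
      obtain ⟨b, hb⟩ := Ideal.Quotient.mk_surjective (Multiplicative.toAdd g)
      -- lift the class to an exactly anti-fixed `y₀` by the τ-LIFT (`τ + στ = 1`, ★ `UnramifiedLocalConjDatum.trace`), and take `p(1, t y₀, 1)`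
      obtain ⟨τ, hτv, hτ⟩ := hd.trace
      set y₀ : K := (b : K) - τ * ((b : K) + σ b) with hy₀
      have hσy₀ : σ y₀ = -y₀ := by
        rw [hy₀, map_sub, map_mul, map_add, hσσ]
        linear_combination (-((b : K) + σ b)) * hτ
      have vy₀ : Valued.v y₀ ≤ 1 := by
        rw [hy₀]
        refine Valuation.map_sub_le _ b.2 ?_
        rw [map_mul]; exact mul_le_one' hτv (Valuation.map_add_le _ b.2 (by rw [hσv]; exact b.2))
      have vx : Valued.v (t * y₀) ≤ 1 := by rw [map_mul]; exact mul_le_one' ht1 vy₀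
      have hσx : σ (t * y₀) = -(t * y₀) := by rw [map_mul, hσt, hσy₀, mul_neg]
      obtain ⟨p, hp, hcoe⟩ := exists_mem_flickerPH_coe_eq' σ hJ hσσ hσv h2 hc (by rw [map_one] : Valued.v (1 : K) = 1) vx hσx
        (by rw [map_one] : Valued.v (1 : K) = 1) (by rw [map_one, mul_one])
      have hp0 : p ∈ flickerPH0 σ J c t := by
        refine (mem_flickerPH0_iff_of_coe_eq σ hJ hσv hσσ hp hcoe (by rw [map_one]) (by rw [map_one]) (by rw [map_one, mul_one]) t).2 ⟨?_, ?_⟩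
        · rw [inv_one, mul_one, sub_self, map_zero]; exact zero_le
        · rw [map_mul]; exact (mul_le_mul' le_rfl vy₀).trans (by rw [mul_one])
      refine ⟨⟨p, hp0⟩, ?_⟩
      change Multiplicative.ofAdd (toQuotPow m (chi p)) = g
      have c1 : chi p = y₀ := by
        rw [hchi p 1 (t * y₀) 1 hcoe one_ne_zero, inv_one, mul_one, sub_self, mul_zero, map_zero, add_zero, sub_zero, mul_div_cancel_left₀ _ ht0]
      rw [c1, ← ofAdd_toAdd g, ← hb, toQuotPow_of_le m vy₀]
      congr 1
      rw [Ideal.Quotient.eq, mem_maximalIdeal_pow_iff_v_le hd.vϖ]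
      rw [← hb, hσq, Ideal.quotientMap_mk, ← map_neg, Ideal.Quotient.eq] at hg
      have hg' := (mem_maximalIdeal_pow_iff_v_le hd.vϖ m _).1 hg
      change Valued.v (σ (b : K) - -(b : K)) ≤ _ at hg'
      change Valued.v (y₀ - (b : K)) ≤ _
      have : y₀ - (b : K) = -τ * (σ (b : K) - -(b : K)) := by rw [hy₀]; ring
      rw [this, map_mul, Valuation.map_neg]
      exact (mul_le_mul' hτv hg').trans (by rw [one_mul])
  -- count
  rw [← hker, Subgroup.index_ker]
  refine Nat.card_congr
    { toFun := fun g => ⟨Multiplicative.toAdd g.1, (hrange g.1).1 g.2⟩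
      invFun := fun β => ⟨Multiplicative.ofAdd β.1, (hrange _).2 (by simpa using β.2)⟩
      left_inv := fun g => by simp
      right_inv := fun β => by simp }

end Index

end UnitaryGroup

end Literature.NumberTheory.Automorphic
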